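import Literature.NumberTheory.EllipticCurves.WeierstrassSigmaQProductProofs
import Literature.NumberTheory.EllipticCurves.NeronComponentDataProofs
import HarnessLib

/-!
# Szpiro ⇒ Lang over `ℚ`: the Kodaira–Néron input discharged; frontier = Petsche's Lemma 3

Pure proofs (theorems only) in topic `NumberTheory/EllipticCurves` (family `abc`, G06), for the
named facts `Literature.NumberTheory.EllipticCurves.Petsche2006_langHeightLowerBound` (Petsche,
New York J. Math. 12 (2006), Thm. 2 over `ℚ`), `…Petsche2006_card_smallPoints_le` (Prop. 7) and
`…szpiro_imp_langHeightLowerBoundConjecture` (Hindry–Silverman 1988, Thm. 0.3).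

The printed frontier of their formal proof was
`Petsche2006_card_smallPoints_le_of_lemma3_kodairaNeron (h3) (h4) (hsplit)`
(`WeierstrassSigmaQProductProofs.lean`): Petsche's Lemma 3 and the two Kodaira–Néron named facts of
`KodairaNeron.lean` (`index_goodReductionSubgroup_le_four`,
`index_goodReductionSubgroup_of_hasSplitMultiplicativeReduction`, the latter including the cyclicity
of `E(K)/E₀(K)`) at the local minimal models over the completions `ℚ_v`. What Petsche's proof of
Prop. 7 actually uses of Kodaira–Néron (p. 264, the parenthetical after display (30): *"if `E/k_v`
has split multiplicative reduction then `δ_v = c_v` and `η_v = 1` …; while otherwise `η_v ≤ δ_v`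
and `c_v ≤ 4`"*) is, at a place `v` with finite residue field, `1 ≤ c_v`, `c_v = ord_v(Δ_min)` for
split multiplicative reduction and `c_v ≤ 4` otherwise — and all of this is now **proved** in the
tree, elementarily, through Tate's algorithm: `c_v = ord_v(Δ_min)` for split `Iₙ`
(`localTamagawaNumber_eq_ordMinimalDiscriminant_of_hasSplitMultiplicativeReductionAt`,
`NeronComponentIndexSplitProofs`), `c_v ∈ {1, 2}` for non-split `Iₙ` (`NonsplitProofs`), `c_v = 1`
for `I₀` (`TamagawaProofs`), and `c_v ∈ {1, 2, 3, 4}` for the additive types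
(`NeronComponentIndexProofs`, `…TypeIII/IIIstar/IV/IVstar/I0star/InstarProofs`), the type being
read off `W.kodairaSymbolAt v` (`TateAlgorithmProofs`). This file packages that case analysis
(the one of `nonempty_neronComponentData_holds`, `NeronComponentDataProofs`) as

* `kodairaNeron_tamagawaNumberAt` — **Kodaira–Néron at a finite place of `ℚ`, unconditionally**:
  `1 ≤ c_v`, split `⇒ c_v = ord_v(Δ_min)`, non-split `⇒ c_v ≤ 4`;
* `conductorExponent_mul_tamagawaNumberAt_sq_le` — Petsche's display (30), `(η_v c_v)² ≤ 16 δ_v²`,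
  with `1 ≤ c_v`, unconditionally;

and feeds it to the Jensen/Ogg assembly `Petsche2006_le_finsum_localHeightDiscSum_of_localBound`
(`LangHeightNonarchEstimateProofs`), the proved local decomposition ATAEC VI.2.1
(`canonicalHeight_eq_two_mul_sum_neronLocalHeight_holds`) and the proved archimedean step
(`Petsche2006_exists_subset_le_neronLocalHeight_real_holds`), giving the **new frontier**

* `Petsche2006_le_finsum_localHeightDiscSum_of_lemma3`,
  `Petsche2006_card_smallPoints_le_of_lemma3`, `Petsche2006_langHeightLowerBound_of_lemma3`,
  `szpiro_imp_langHeightLowerBoundConjecture_of_lemma3`: Petsche's Prop. 7, Thm. 2 over `ℚ` and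
  Szpiro ⇒ Lang over `ℚ`, conditional on the **single** named fact `Petsche2006_lemma3`
  (`LangHeightNonarchEstimate.lean`; Petsche's Lemma 3 = a variant of Hindry–Silverman, *On Lehmer's
  conjecture for elliptic curves*, Prop. 1.2: the lower bound
  `Λ_v(Z) ≥ (1/c_v² − 1/N)(1/12) log|1/Δ_v|_v` for the local height–discriminant sum at a finite
  place, whose printed proof is the explicit description of `λ_v` on the components of
  `E(k_v)/E₀(k_v)` by Tate's uniformisation).

## References

* C. Petsche, *Small rational points on elliptic curves over number fields*, New York J. Math. 12
  (2006), 257–268; arXiv math/0508160: Lemma 3, Prop. 7 and its proof (display (30)), Thm. 2.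
* M. Hindry, J. H. Silverman, *The canonical height and integral points on elliptic curves*,
  Invent. Math. 93 (1988), 419–450, Thm. 0.3.
* J. H. Silverman, *Advanced Topics in the Arithmetic of Elliptic Curves*, GTM 151 (1994), Cor.
  IV.9.2(d), Thm. IV.9.4 and Table 4.1; *The Arithmetic of Elliptic Curves*, 2nd ed. (2009),
  Thm. VII.6.1 (Kodaira–Néron).

## Design

No definitions; theorems only; namespace = path. `NeronComponentDataAssembly` declares
`Literature.NumberTheory.EllipticCurves.WeierstrassCurve`, so the Mathlib namespace is opened with
`_root_` (CONVENTIONS §2). `W.tamagawaNumberAt v` is the `abbrev` of `LangHeightNonarchEstimate.lean`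
for the inline `(W.baseChange ℚ_v).localTamagawaNumber O_v` of the Tamagawa files, so their theorems
rewrite it after `show`.
-/

noncomputable section

open scoped Classical

open IsDedekindDomain

namespace Literature.NumberTheory.EllipticCurves

open _root_.WeierstrassCurve _root_.WeierstrassCurve.Affine.Point Petsche2006 Rat.HeightOneSpectrum

/-! ### Kodaira–Néron at the finite places of `ℚ`, unconditionally -/

/-- **The Kodaira–Néron theorem at a finite place of `ℚ`** (Silverman, AEC Thm. VII.6.1; ATAEC
Cor. IV.9.2(d) with Thm. IV.9.4 and Table 4.1), in the form used by Petsche (2006, p. 264): for an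
elliptic curve `W/ℚ` and a prime `v`, the local Tamagawa number `c_v = [E(ℚ_v) : E₀(ℚ_v)]`
(`W.tamagawaNumberAt v`, computed on the local minimal model) satisfies `1 ≤ c_v`;
`c_v = ord_v(Δ_min)` if the reduction is split multiplicative; and `c_v ≤ 4` otherwise. Proof: the
finiteness for a finite residue field (`index_goodReductionSubgroup_ne_zero_of_finite_residueField`),
the split case `localTamagawaNumber_eq_ordMinimalDiscriminant_of_hasSplitMultiplicativeReductionAt`,
and otherwise a case analysis on the Kodaira symbol `W.kodairaSymbolAt v` returned by Tate's
algorithm: `I₀` is good reduction (`c_v = 1`), `Iₙ` with `n ≥ 1` is multiplicative, hence non-split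
here (`c_v ∈ {1, 2}`, `NonsplitProofs`), and the additive types have `c_v ∈ {1, 2, 3, 4}` by the
nine discharged local-index facts of `NeronComponentIndex.lean`.
[cite: SilvermanAEC2009, Thm VII.6.1] -/
theorem kodairaNeron_tamagawaNumberAt (W : WeierstrassCurve ℚ) [W.IsElliptic]
    (v : HeightOneSpectrum ℤ) :
    1 ≤ W.tamagawaNumberAt v ∧
      (W.HasSplitMultiplicativeReductionAt v → W.tamagawaNumberAt v = W.ordMinimalDiscriminant v) ∧
      (¬ W.HasSplitMultiplicativeReductionAt v → W.tamagawaNumberAt v ≤ 4) := by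
  haveI : PerfectField (IsLocalRing.ResidueField (v.adicCompletionIntegers ℚ)) :=
    PerfectField.ofFinite
  haveI := W.isElliptic_localMinimalModel v
  refine ⟨Nat.one_le_iff_ne_zero.mpr
      ((W.localMinimalModel v).index_goodReductionSubgroup_ne_zero_of_finite_residueField _),
    fun hs => localTamagawaNumber_eq_ordMinimalDiscriminant_of_hasSplitMultiplicativeReductionAt
      v W hs,
    fun hns => ?_⟩
  show (W.baseChange (v.adicCompletion ℚ)).localTamagawaNumber (v.adicCompletionIntegers ℚ) ≤ 4
  rcases hk : W.kodairaSymbolAt v with (_ | m) | _ | _ | _ | (_ | n) | _ | _ | _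
  · -- `I₀`: good reduction, `c_v = 1`
    have hg : W.HasGoodReductionAt v :=
      (WeierstrassCurve.isGood_kodairaSymbolAt_iff_holds v W).mp hk
    rw [localTamagawaNumber_eq_one_of_good' v W
      (WeierstrassCurve.localTamagawaNumber_eq_one_of_hasGoodReduction_holds _ _) hg]
    norm_num
  · -- `Iₘ₊₁`: multiplicative, non-split by hypothesis, `c_v ∈ {1, 2}`
    obtain ⟨hmult, -⟩ :=
      (WeierstrassCurve.kodairaSymbolAt_eq_I_iff_holds v W m.succ_ne_zero).mp hk
    rw [localTamagawaNumber_of_hasNonsplitMultiplicativeReductionAt_holds v W hmult hns]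
    split_ifs <;> norm_num
  · -- `II`
    rw [localTamagawaNumber_eq_one_of_kodairaSymbolAt_eq_II_holds v W hk]
    norm_num
  · -- `III`
    rw [localTamagawaNumber_eq_two_of_kodairaSymbolAt_eq_III_holds v W hk]
    norm_num
  · -- `IV`
    rcases localTamagawaNumber_of_kodairaSymbolAt_eq_IV_holds v W hk with h | h <;> omega
  · -- `I₀*`
    rcases localTamagawaNumber_of_kodairaSymbolAt_eq_Istar_zero_holds v W hk with h | h | h <;>
      omega
  · -- `Iₙ₊₁*`
    rcases localTamagawaNumber_of_kodairaSymbolAt_eq_Istar_succ_holds v W n hk with h | h <;>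
      omega
  · -- `IV*`
    rcases localTamagawaNumber_of_kodairaSymbolAt_eq_IVstar_holds v W hk with h | h <;> omega
  · -- `III*`
    rw [localTamagawaNumber_eq_two_of_kodairaSymbolAt_eq_IIIstar_holds v W hk]
    norm_num
  · -- `II*`
    rw [localTamagawaNumber_eq_one_of_kodairaSymbolAt_eq_IIstar_holds v W hk]
    norm_num

/-- **Petsche 2006, proof of Prop. 7, display (30) and the parenthetical following it** (p. 264),
over `ℚ`, at every finite place and now unconditionally: `1 ≤ c_v` and `(η_v c_v)² ≤ 16 δ_v²`
(`η_v` the conductor exponent, `δ_v = ord_v(Δ_min)`, `c_v` the local Tamagawa number). *"(To see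
this, recall that if `E/k_v` has split multiplicative reduction then `δ_v = c_v` and `η_v = 1`, and
(30) holds; while otherwise `η_v ≤ δ_v` and `c_v ≤ 4`, and (30) follows in this case as well.)"* —
from `kodairaNeron_tamagawaNumberAt`, `f_v = 1` for multiplicative reduction
(`WeierstrassCurve.conductorExponent_eq_one_iff_holds`) and Ogg's `f_v ≤ ord_v Δ_min`
(`WeierstrassCurve.conductorExponent_le_ordMinimalDiscriminant`).
[cite: Petsche2006, proof of Prop. 7, (30)] -/
theorem conductorExponent_mul_tamagawaNumberAt_sq_le (W : WeierstrassCurve ℚ) [W.IsElliptic]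
    (v : HeightOneSpectrum ℤ) :
    1 ≤ W.tamagawaNumberAt v ∧
      (W.conductorExponent v * W.tamagawaNumberAt v) ^ 2 ≤ 16 * W.ordMinimalDiscriminant v ^ 2 := by
  obtain ⟨h1, hs, hother⟩ := kodairaNeron_tamagawaNumberAt W v
  refine ⟨h1, ?_⟩
  have hOgg := conductorExponent_le_ordMinimalDiscriminant v W
  by_cases hsp : W.HasSplitMultiplicativeReductionAt v
  · have hη : W.conductorExponent v = 1 :=
      (conductorExponent_eq_one_iff_holds v W).mpr hsp.hasMultiplicativeReductionAt
    rw [hs hsp, hη, one_mul]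
    nlinarith
  · have hc := hother hsp
    calc (W.conductorExponent v * W.tamagawaNumberAt v) ^ 2
        ≤ (W.conductorExponent v * 4) ^ 2 := by gcongr
      _ = 16 * W.conductorExponent v ^ 2 := by ring
      _ ≤ 16 * W.ordMinimalDiscriminant v ^ 2 := by gcongr

/-! ### The new frontier: everything from Petsche's Lemma 3 -/

/-- **Petsche's non-archimedean estimate over `ℚ` from Lemma 3 alone**
(`Petsche2006_le_finsum_localHeightDiscSum`; Petsche 2006, proof of Prop. 7, pp. 264–265): the
Jensen/Ogg assembly `Petsche2006_le_finsum_localHeightDiscSum_of_localBound` fed with the proved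
Kodaira–Néron bound `conductorExponent_mul_tamagawaNumberAt_sq_le` and the proved local
decomposition ATAEC VI.2.1 (`canonicalHeight_eq_two_mul_sum_neronLocalHeight_holds`).
[cite: Petsche2006, proof of Prop. 7] -/
theorem Petsche2006_le_finsum_localHeightDiscSum_of_lemma3 (h3 : Petsche2006_lemma3) :
    Petsche2006_le_finsum_localHeightDiscSum :=
  Petsche2006_le_finsum_localHeightDiscSum_of_localBound h3
    (fun W _ v => conductorExponent_mul_tamagawaNumberAt_sq_le W v)
    canonicalHeight_eq_two_mul_sum_neronLocalHeight_holds

/-- **Petsche 2006, Proposition 7 over `ℚ` from Lemma 3 alone** (`Petsche2006_card_smallPoints_le`;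
New York J. Math. 12 (2006), Prop. 7, pp. 263–265): the non-archimedean estimate
(`Petsche2006_le_finsum_localHeightDiscSum_of_lemma3`), the proved archimedean step
(`Petsche2006_exists_subset_le_neronLocalHeight_real_holds`: complex uniformisation, ATAEC VI.3.4 and
Hindry–Silverman's Lemma 5) and the proved local decomposition ATAEC VI.2.1, assembled by
`Petsche2006_card_smallPoints_le_of` (parallelogram law, Petsche's Lemma 6).
[cite: Petsche2006, Prop. 7] -/
theorem Petsche2006_card_smallPoints_le_of_lemma3 (h3 : Petsche2006_lemma3) :
    Petsche2006_card_smallPoints_le :=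
  Petsche2006_card_smallPoints_le_of (Petsche2006_le_finsum_localHeightDiscSum_of_lemma3 h3)
    Petsche2006_exists_subset_le_neronLocalHeight_real_holds
    canonicalHeight_eq_two_mul_sum_neronLocalHeight_holds

/-- **Petsche 2006, Theorem 2 over `ℚ` from Lemma 3 alone** (`Petsche2006_langHeightLowerBound`;
New York J. Math. 12 (2006), Thm. 2: `ĥ(P) ≥ c(1, σ) log N(Δ_{E/ℚ})` for non-torsion `P ∈ E(ℚ)`):
Theorem 2 from Proposition 7 (`Petsche2006_langHeightLowerBound_of_card_smallPoints_le`, the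
multiples `O, P, …, ⌊A⌋P`) and Proposition 7 from Lemma 3
(`Petsche2006_card_smallPoints_le_of_lemma3`). [cite: Petsche2006, Thm. 2] -/
theorem Petsche2006_langHeightLowerBound_of_lemma3 (h3 : Petsche2006_lemma3) :
    Petsche2006_langHeightLowerBound :=
  Petsche2006_langHeightLowerBound_of_card_smallPoints_le
    (Petsche2006_card_smallPoints_le_of_lemma3 h3)

/-- **Szpiro ⇒ Lang's height lower bound over `ℚ` from Lemma 3 alone**
(`szpiro_imp_langHeightLowerBoundConjecture`; Hindry–Silverman, Invent. Math. 93 (1988), Thm. 0.3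
with the remark after Conj. 0.4; Silverman, AEC 2nd ed., Thm. VIII.9.10(b)): everything in the
printed chain except Petsche's Lemma 3 — Kodaira–Néron, Ogg's formula, the local decomposition of
`ĥ`, the archimedean theory (ATAEC VI.1–VI.3, Hindry–Silverman's Lemma 5, the `q`-product of `σ`),
Prop. 7, Thm. 2 and the Szpiro-ratio bound — is proved in the tree.
[cite: HindrySilverman1988, Thm 0.3] -/
theorem szpiro_imp_langHeightLowerBoundConjecture_of_lemma3 (h3 : Petsche2006_lemma3) :
    szpiro_imp_langHeightLowerBoundConjecture :=
  szpiro_imp_langHeightLowerBoundConjecture_of (Petsche2006_langHeightLowerBound_of_lemma3 h3)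

end Literature.NumberTheory.EllipticCurves

end
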